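/-
Copyright (c) 2026 the pub-hodgecm-mathlib formalisation cell (harness21).  Prover seat hodgecm-mathlib-K2E3-p12 (g2), Track B «K2-LIT» ∕ h413
(`stmt-HodgeConjecture-24833`), line `K2_E3_EllipticInputs`, unit U12-d «Harish-Chandra characters»: ON THE ONE-PLACE UNITARY MODEL `U(σ, J)(F)` (any
non-archimedean local field `F`): the bound «`|D|^{1∕2} Θ_π` bounded near `s₀`» at REGULAR `s₀`, at SCALAR `s₀` from the bound at `1`, and for `N = 2` at EVERY
semisimple `s₀` from the bound at `1` — the non-split twin of ★ `K2E3GLnNormalizedCharBddNearSemisimpleOfIdentity`.  2026-09-04.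
-/
import Summits.HodgeConjecture.HodgeConjecture.Theorems.K2E3NormalizedCharBddNearSemisimpleTwoOfIdentity   -- ★ p855904 (this seat): generic `apply_mul_eq_of_mem_center`; ★ `unitRel_smul_iff`; ★ p855802 `exists_eq_smul_one_of_isSemisimple_of_not_separable`
import Summits.HodgeConjecture.HodgeConjecture.Theorems.K2E3CharLocBddOfLocal                          -- ★ p855025: `isRegularElt_of_unit_mul_det_pow_eq_discr`
import Summits.HodgeConjecture.HodgeConjecture.Theorems.K2E3GLnNormalizedCharBddNearSemisimpleOfIdentity     -- ★ p856219 (this seat): `coe_eq_discr_mul_det_inv_pow` (GL_N(F) twin)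
import Literature.NumberTheory.Automorphic.LocalRingUnitModulusProduct                                -- ★ `distribHaarChar_eq_normAbs`
import Literature.NumberTheory.Automorphic.LocalFieldHaarBalls                                        -- ★ `LocalFieldHaar.continuous_normAbs`
import HarnessLib

/-!
# K2_E3 road (h413 = stmt-HodgeConjecture-24833), unit U12-d on the model `U(σ, J)(F)` — REGULAR points, SCALAR TRANSLATION, and `N = 2` FROM THE IDENTITY

Cell `pub/hodgecm-mathlib` (D-0151), Track B (21-frontier RULING «PUSH BOTH» 2026-09-03, director req624), seat K2E3-p12 (g2), line lead of row 12 (12-S).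
`--supports stmt-HodgeConjecture-24833 --as helper`; THEOREMS ONLY (no definition ∕ instance ∕ notation ∕ named fact ∕ `sorry`); never imports `Cruxes/…/Lines`.

★ p856182 reduces socket U12-d at NON-SPLIT places to the statement (12-U) on `G₀ = U(σ_w, H_w)(L_w) = ↥(unitaryGroupOfForm σ J)` at every semisimple `s₀`: «`∃ U₀ ∋ s₀`
open, `∃ B`, `√√‖u₀‖_F·|Θ₀ g| ≤ B` for `g ∈ U₀`, `u₀·det(g)^{N−1} = disc χ_g`», for `Θ₀` locally constant at the regular points and representing an admissible character.
GENERIC over a non-archimedean local field `F`, any `σ`, `J`: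
* §1 `exists_nhds_uWeight_le` — the weight `√√‖u₀‖_F` is locally bounded at EVERY point (`u₀ = disc χ_g·det(g⁻¹)^{N−1}`, ★ p856219; continuity); `uNormalizedCharBddNear_of_eventually_eq`
  — (12-U) at every point of local constancy of `Θ₀`, in particular at REGULAR `s₀`.
* §2 `uNormalizedCharBddNear_smul_of_one` — (12-U) at a SCALAR `z ∈ U(σ,J)(F)` (matrix `a • 1`; every central element is scalar, ★ `exists_coe_eq_scalar_of_mem_center_unitaryGroupOfForm`)
  ⟸ (12-U) at `1` (`Θ₀(zg) = ω_{π₀}(z)Θ₀(g)` by ★ `apply_mul_eq_of_mem_center`, weights by ★ `unitRel_smul_iff`).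
* §3 **`uTwo_normalizedCharBddNearSemisimple_of_one`** (`F` perfect): on `U(σ,J)(F) ≤ GL₂(F)` a semisimple `s₀` is regular or scalar (★
  `exists_eq_smul_one_of_isSemisimple_of_not_separable`), so (12-U) at EVERY semisimple `s₀` ⟸ (12-U) at `1` — which ★ `K2E3UNormalizedCharBddNearIdentityOfLieCore` (p856250)
  reduces to (L-A_U)+(L-B_U) on `𝔲(σ,J)`.  With the `GL₂` twin ★ p856219: at `N = 2` socket U12-d costs, at every place, exactly the Lie-algebra core at the identity.
[HarishChandra1999AdmissibleDistributions, Thm. 16.3 p. 77, §17, §21 p. 87] [BushnellHenniart2006, §2.6 Cor. 1] [Borel1991, I.4].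
HONEST LABEL: HC_CM is proved only modulo the 7 printed citations (2 remaining named inputs: hLiu418 = stmt-HodgeConjecture-24832, h413 =
stmt-HodgeConjecture-24833) until rung 0 closes; reductions only.

## References
* [HarishChandra1999AdmissibleDistributions] Harish-Chandra (DeBacker–Sally), *Admissible Invariant Distributions on Reductive p-adic Groups* (1999), Thm. 16.3, §17, §21.
* [BushnellHenniart2006] C. J. Bushnell, G. Henniart, *The Local Langlands Conjecture for GL(2)* (2006), §2.6 Corollary 1.
* [Borel1991] A. Borel, *Linear Algebraic Groups*, 2nd ed. (1991), I.4 (4.2)–(4.4).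
-/

set_option autoImplicit false
set_option linter.dupNamespace false   -- `Summit.HodgeConjecture.HodgeConjecture.…` (D-0017 nested layout; lakefile exemption for Summits)

noncomputable section

open MeasureTheory Filter Topology Polynomial
open scoped Matrix MatrixGroups NNReal
open Literature.NumberTheory.Rogawski1990 Literature.NumberTheory.Automorphic Literature.NumberTheory.Automorphic.UnitaryGroup
open Literature.NumberTheory.GaloisRepresentations Literature.NumberTheory.GaloisRepresentations.IsNonarchimedeanLocalField
open Summit.HodgeConjecture.HodgeConjecture.Cruxes.H413.K2E3NormalizedCharBddNearSemisimpleRegular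
open Summit.HodgeConjecture.HodgeConjecture.Cruxes.H413.K2E3NormalizedCharBddNearSemisimpleTwoOfIdentity
open Summit.HodgeConjecture.HodgeConjecture.Cruxes.H413.K2E3CharLocBddOfLocal
open Summit.HodgeConjecture.HodgeConjecture.Cruxes.H413.K2E3CharpolyDiscrSmul
open Summit.HodgeConjecture.HodgeConjecture.Cruxes.H413.K2E3CharLocIntNearSemisimpleTwoOfIdentity

namespace Summit.HodgeConjecture.HodgeConjecture.Cruxes.H413.K2E3UNormalizedCharBddNearSemisimpleOfIdentity

variable {F : Type*} [Field F] [ValuativeRel F] [TopologicalSpace F] [IsNonarchimedeanLocalField F] {N : ℕ}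
  (σ : F →+* F) (J : Matrix (Fin N) (Fin N) F)

/-! ## §1  The weight `√√‖u₀‖_F` on `U(σ, J)(F)` is locally bounded; (12-U) at a point of local constancy -/

/-- **The weight `√√‖u₀‖_F` is locally bounded at EVERY point of `U(σ, J)(F)`.** [cite: HarishChandra1999AdmissibleDistributions, Thm. 16.3, §17] -/
theorem exists_nhds_uWeight_le (s₀ : ↥(unitaryGroupOfForm σ J)) :
    ∃ U : Set ↥(unitaryGroupOfForm σ J), IsOpen U ∧ s₀ ∈ U ∧ ∃ W : ℝ, ∀ g ∈ U, ∀ u₀ : Fˣ,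
      (u₀ : F) * ((((g : GL (Fin N) F)) : Matrix (Fin N) (Fin N) F).det) ^ (N - 1) = ((((g : GL (Fin N) F)) : Matrix (Fin N) (Fin N) F).charpoly).discr →
      ((NNReal.sqrt (NNReal.sqrt (unitModulusChar F u₀)) : ℝ≥0) : ℝ) ≤ W := by
  set Φ : ↥(unitaryGroupOfForm σ J) → ℝ≥0 := fun g =>
    normAbs F (((g : GL (Fin N) F) : Matrix (Fin N) (Fin N) F).charpoly.discr *
      (((g : GL (Fin N) F)⁻¹ : GL (Fin N) F) : Matrix (Fin N) (Fin N) F).det ^ (N - 1)) with hΦ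
  have hΦc : Continuous Φ := by
    refine LocalFieldHaar.continuous_normAbs.comp ?_
    have hv : Continuous fun g : ↥(unitaryGroupOfForm σ J) => (((g : GL (Fin N) F)) : Matrix (Fin N) (Fin N) F) :=
      Units.continuous_val.comp continuous_subtype_val
    have hi : Continuous fun g : ↥(unitaryGroupOfForm σ J) => (((((g : GL (Fin N) F))⁻¹ : GL (Fin N) F)) : Matrix (Fin N) (Fin N) F) :=
      Units.continuous_coe_inv.comp continuous_subtype_val
    exact (continuous_discr_charpoly.comp hv).mul (hi.matrix_det.pow _)
  refine ⟨Φ ⁻¹' Set.Iio (Φ s₀ + 1), hΦc.isOpen_preimage _ isOpen_Iio, ?_, ((NNReal.sqrt (NNReal.sqrt (Φ s₀ + 1)) : ℝ≥0) : ℝ), fun g hg u₀ hu => ?_⟩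
  · exact Set.mem_preimage.2 (Set.mem_Iio.2 (lt_add_of_pos_right _ zero_lt_one))
  · have hmod : unitModulusChar F u₀ = Φ g := by
      rw [unitModulusChar, distribHaarChar_eq_normAbs, K2E3GLnNormalizedCharBddNearSemisimpleOfIdentity.coe_eq_discr_mul_det_inv_pow _ u₀ hu]
    rw [hmod]
    exact NNReal.coe_le_coe.2 (NNReal.sqrt_le_sqrt.2 (NNReal.sqrt_le_sqrt.2 (Set.mem_Iio.1 (Set.mem_preimage.1 hg)).le))

/-- **(12-U) at a point where `Θ₀` is locally constant** (in particular at every REGULAR `s₀`). [cite: HarishChandra1999AdmissibleDistributions, Thm. 16.3 p. 77] -/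
theorem uNormalizedCharBddNear_of_eventually_eq (Θ₀ : ↥(unitaryGroupOfForm σ J) → ℂ) (s₀ : ↥(unitaryGroupOfForm σ J)) (hΘ : ∀ᶠ y in 𝓝 s₀, Θ₀ y = Θ₀ s₀) :
    ∃ U₀ : Set ↥(unitaryGroupOfForm σ J), IsOpen U₀ ∧ s₀ ∈ U₀ ∧ ∃ B : ℝ, ∀ g ∈ U₀, ∀ u₀ : Fˣ,
      (u₀ : F) * ((((g : GL (Fin N) F)) : Matrix (Fin N) (Fin N) F).det) ^ (N - 1) = ((((g : GL (Fin N) F)) : Matrix (Fin N) (Fin N) F).charpoly).discr →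
      ((NNReal.sqrt (NNReal.sqrt (unitModulusChar F u₀)) : ℝ≥0) : ℝ) * ‖Θ₀ g‖ ≤ B := by
  obtain ⟨V, hVsub, hVo, hsV⟩ := mem_nhds_iff.1 hΘ
  obtain ⟨U, hUo, hsU, W, hW⟩ := exists_nhds_uWeight_le σ J s₀
  refine ⟨U ∩ V, hUo.inter hVo, ⟨hsU, hsV⟩, W * ‖Θ₀ s₀‖, fun g hg u₀ hu => ?_⟩
  have hΘg : Θ₀ g = Θ₀ s₀ := hVsub hg.2
  rw [hΘg]
  exact mul_le_mul_of_nonneg_right (hW g hg.1 u₀ hu) (norm_nonneg _)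

/-! ## §2  Scalar translation on `U(σ, J)(F)`: (12-U) at a scalar point from (12-U) at `1` -/

set_option maxHeartbeats 800000 in
/-- **(12-U) AT A SCALAR `z ∈ U(σ,J)(F)` (matrix `a • 1`) FROM (12-U) AT `1`** (`π₀` admissible irreducible, `Θ₀` locally constant at the regular points and representing
`χ_{π₀}`): `z` is central, `Θ₀(zg) = ω_{π₀}(z)·Θ₀(g)` (★ `apply_mul_eq_of_mem_center`), admissible units at `zg` and `g` agree (★ `unitRel_smul_iff`).
[cite: HarishChandra1999AdmissibleDistributions, Thm. 16.3 p. 77, §21 p. 87] [cite: BushnellHenniart2006, §2.6 Corollary 1] -/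
theorem uNormalizedCharBddNear_smul_of_one [NonarchimedeanGroup ↥(unitaryGroupOfForm σ J)] [LocallyCompactSpace ↥(unitaryGroupOfForm σ J)]
    [SecondCountableTopology ↥(unitaryGroupOfForm σ J)] [MeasurableSpace ↥(unitaryGroupOfForm σ J)] [BorelSpace ↥(unitaryGroupOfForm σ J)]
    (μ₀ : Measure ↥(unitaryGroupOfForm σ J)) [μ₀.IsHaarMeasure]
    (r₀ : SmoothIrrep ↥(unitaryGroupOfForm σ J)) (hadm : r₀.ρ.IsAdmissible) (Θ₀ : ↥(unitaryGroupOfForm σ J) → ℂ)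
    (hloc₀ : ∀ x₀ : ↥(unitaryGroupOfForm σ J), IsRegularElt (x₀ : GL (Fin N) F) → ∀ᶠ y in 𝓝 x₀, Θ₀ y = Θ₀ x₀)
    (hrep₀ : ∀ φ₀ : ↥(unitaryGroupOfForm σ J) → ℂ, IsLocSmooth φ₀ → (IrrClass.mk r₀).smoothTrace μ₀ φ₀ = ∫ x, φ₀ x * Θ₀ x ∂μ₀)
    (z : ↥(unitaryGroupOfForm σ J)) (a : Fˣ) (hz : (((z : GL (Fin N) F)) : Matrix (Fin N) (Fin N) F) = (a : F) • (1 : Matrix (Fin N) (Fin N) F))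
    (h1 : ∃ U₀ : Set ↥(unitaryGroupOfForm σ J), IsOpen U₀ ∧ (1 : ↥(unitaryGroupOfForm σ J)) ∈ U₀ ∧ ∃ B : ℝ, ∀ g ∈ U₀, ∀ u₀ : Fˣ,
      (u₀ : F) * ((((g : GL (Fin N) F)) : Matrix (Fin N) (Fin N) F).det) ^ (N - 1) = ((((g : GL (Fin N) F)) : Matrix (Fin N) (Fin N) F).charpoly).discr →
      ((NNReal.sqrt (NNReal.sqrt (unitModulusChar F u₀)) : ℝ≥0) : ℝ) * ‖Θ₀ g‖ ≤ B) :
    ∃ U₀ : Set ↥(unitaryGroupOfForm σ J), IsOpen U₀ ∧ z ∈ U₀ ∧ ∃ B : ℝ, ∀ g ∈ U₀, ∀ u₀ : Fˣ,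
      (u₀ : F) * ((((g : GL (Fin N) F)) : Matrix (Fin N) (Fin N) F).det) ^ (N - 1) = ((((g : GL (Fin N) F)) : Matrix (Fin N) (Fin N) F).charpoly).discr →
      ((NNReal.sqrt (NNReal.sqrt (unitModulusChar F u₀)) : ℝ≥0) : ℝ) * ‖Θ₀ g‖ ≤ B := by
  -- `z` is central in `U(σ,J)(F)` (its matrix is scalar)
  have hzc : z ∈ Subgroup.center ↥(unitaryGroupOfForm σ J) := by
    rw [Subgroup.mem_center_iff]
    intro g
    apply Subtype.ext
    change (g : GL (Fin N) F) * (z : GL (Fin N) F) = (z : GL (Fin N) F) * (g : GL (Fin N) F)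
    ext1
    rw [Units.val_mul, Units.val_mul, hz, mul_smul_comm, smul_mul_assoc, mul_one, one_mul]
  obtain ⟨ω, hω⟩ := exists_apply_eq_algebraMap_of_mem_center r₀ hzc
  obtain ⟨U, hUo, h1U, B, hB⟩ := h1
  refine ⟨(fun x => z * x) '' U, isOpenMap_mul_left z U hUo, ⟨1, h1U, mul_one z⟩, ‖ω‖ * max B 0, ?_⟩
  rintro g' ⟨g, hgU, rfl⟩ u₀ hu
  have hmat : ((((z * g : ↥(unitaryGroupOfForm σ J)) : GL (Fin N) F)) : Matrix (Fin N) (Fin N) F) = (a : F) • ((((g : GL (Fin N) F)) : Matrix (Fin N) (Fin N) F)) := by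
    change (((z : GL (Fin N) F) * (g : GL (Fin N) F) : GL (Fin N) F) : Matrix (Fin N) (Fin N) F) = _
    rw [Units.val_mul, hz, smul_mul_assoc, one_mul]
  rw [hmat] at hu
  have hu' := (unitRel_smul_iff _ a (u₀ : F)).1 hu
  have hreg : IsRegularElt (g : GL (Fin N) F) := isRegularElt_of_unit_mul_det_pow_eq_discr _ u₀ (N - 1) hu'
  have hreg' : IsRegularElt ((z * g : ↥(unitaryGroupOfForm σ J)) : GL (Fin N) F) := by
    refine isRegularElt_of_unit_mul_det_pow_eq_discr _ u₀ (N - 1) ?_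
    rw [hmat]
    exact hu
  have hΘ : Θ₀ (z * g) = ω * Θ₀ g := apply_mul_eq_of_mem_center μ₀ r₀ hadm hzc hω Θ₀ hrep₀ (hloc₀ g hreg) (hloc₀ (z * g) hreg')
  have hb : ((NNReal.sqrt (NNReal.sqrt (unitModulusChar F u₀)) : ℝ≥0) : ℝ) * ‖Θ₀ g‖ ≤ max B 0 := (hB g hgU u₀ hu').trans (le_max_left _ _)
  rw [hΘ, norm_mul]
  calc ((NNReal.sqrt (NNReal.sqrt (unitModulusChar F u₀)) : ℝ≥0) : ℝ) * (‖ω‖ * ‖Θ₀ g‖)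
      = ‖ω‖ * (((NNReal.sqrt (NNReal.sqrt (unitModulusChar F u₀)) : ℝ≥0) : ℝ) * ‖Θ₀ g‖) := by ring
    _ ≤ ‖ω‖ * max B 0 := mul_le_mul_of_nonneg_left hb (norm_nonneg _)

/-! ## §3  `N = 2`: every semisimple element of `U(σ, J)(F) ≤ GL₂(F)` is regular or scalar -/

set_option maxHeartbeats 800000 in
/-- **(12-U) ON `U(σ,J)(F) ≤ GL₂(F)` AT EVERY SEMISIMPLE POINT FROM (12-U) AT `1`** (`F` perfect): a semisimple `s₀` with separable `χ_{s₀}` is regular (§1), otherwise its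
matrix is scalar (★ `exists_eq_smul_one_of_isSemisimple_of_not_separable`) and §2 applies.  The `N = 2` non-split model input of ★ p856182 reduced to the identity.
[cite: HarishChandra1999AdmissibleDistributions, Thm. 16.3 p. 77] [cite: Borel1991, I.4 (4.2)–(4.4)] -/
theorem uTwo_normalizedCharBddNearSemisimple_of_one [PerfectField F] (σ : F →+* F) (J : Matrix (Fin 2) (Fin 2) F)
    [NonarchimedeanGroup ↥(unitaryGroupOfForm σ J)] [LocallyCompactSpace ↥(unitaryGroupOfForm σ J)]
    [SecondCountableTopology ↥(unitaryGroupOfForm σ J)] [MeasurableSpace ↥(unitaryGroupOfForm σ J)] [BorelSpace ↥(unitaryGroupOfForm σ J)]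
    (μ₀ : Measure ↥(unitaryGroupOfForm σ J)) [μ₀.IsHaarMeasure]
    (r₀ : SmoothIrrep ↥(unitaryGroupOfForm σ J)) (hadm : r₀.ρ.IsAdmissible) (Θ₀ : ↥(unitaryGroupOfForm σ J) → ℂ)
    (hloc₀ : ∀ x₀ : ↥(unitaryGroupOfForm σ J), IsRegularElt (x₀ : GL (Fin 2) F) → ∀ᶠ y in 𝓝 x₀, Θ₀ y = Θ₀ x₀)
    (hrep₀ : ∀ φ₀ : ↥(unitaryGroupOfForm σ J) → ℂ, IsLocSmooth φ₀ → (IrrClass.mk r₀).smoothTrace μ₀ φ₀ = ∫ x, φ₀ x * Θ₀ x ∂μ₀)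
    (h1 : ∃ U₀ : Set ↥(unitaryGroupOfForm σ J), IsOpen U₀ ∧ (1 : ↥(unitaryGroupOfForm σ J)) ∈ U₀ ∧ ∃ B : ℝ, ∀ g ∈ U₀, ∀ u₀ : Fˣ,
      (u₀ : F) * ((((g : GL (Fin 2) F)) : Matrix (Fin 2) (Fin 2) F).det) ^ (2 - 1) = ((((g : GL (Fin 2) F)) : Matrix (Fin 2) (Fin 2) F).charpoly).discr →
      ((NNReal.sqrt (NNReal.sqrt (unitModulusChar F u₀)) : ℝ≥0) : ℝ) * ‖Θ₀ g‖ ≤ B)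
    (s₀ : ↥(unitaryGroupOfForm σ J)) (hss : Module.End.IsSemisimple (Matrix.toLin' ((((s₀ : GL (Fin 2) F)) : Matrix (Fin 2) (Fin 2) F)))) :
    ∃ U₀ : Set ↥(unitaryGroupOfForm σ J), IsOpen U₀ ∧ s₀ ∈ U₀ ∧ ∃ B : ℝ, ∀ g ∈ U₀, ∀ u₀ : Fˣ,
      (u₀ : F) * ((((g : GL (Fin 2) F)) : Matrix (Fin 2) (Fin 2) F).det) ^ (2 - 1) = ((((g : GL (Fin 2) F)) : Matrix (Fin 2) (Fin 2) F).charpoly).discr →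
      ((NNReal.sqrt (NNReal.sqrt (unitModulusChar F u₀)) : ℝ≥0) : ℝ) * ‖Θ₀ g‖ ≤ B := by
  by_cases hreg : IsRegularElt (s₀ : GL (Fin 2) F)
  · exact uNormalizedCharBddNear_of_eventually_eq σ J Θ₀ s₀ (hloc₀ s₀ hreg)
  · rw [isRegularElt_iff] at hreg
    obtain ⟨a, ha⟩ := exists_eq_smul_one_of_isSemisimple_of_not_separable _ hss hreg
    have ha0 : a ≠ 0 := by
      intro h0
      rw [h0, zero_smul] at ha
      have hdet := Matrix.isUnits_det_units ((s₀ : GL (Fin 2) F))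
      haveI : Nonempty (Fin 2) := ⟨0⟩
      rw [ha, Matrix.det_zero] at hdet
      exact not_isUnit_zero hdet
    exact uNormalizedCharBddNear_smul_of_one σ J μ₀ r₀ hadm Θ₀ hloc₀ hrep₀ s₀ (Units.mk0 a ha0) ha h1

end Summit.HodgeConjecture.HodgeConjecture.Cruxes.H413.K2E3UNormalizedCharBddNearSemisimpleOfIdentity

end
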